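import Literature.Computability.AlgebraicComplexity.MonotoneStructure
import Mathlib.Logic.Equiv.Prod
import HarnessLib

/-!
# Set-multilinear monomials as maps, and coefficients of ordered products

Bookkeeping for the `ε`-sensitive monotone lower bound of
Chattopadhyay–Datta–Ghosal–Mukhopadhyay (ITCS 2022, arXiv:2109.06941), §4: "We identify a
monomial `κ_ν ∈ 𝕄[X]` with a map `ν : [n] → [m]` in the following way,
`κ_ν = Π_{i=1}^n x_{i,ν(i)}`. This forms a bijection between set `𝕄[X]` and
`Υ = {ν | ν : [n] → [m]}`"; for a partition `(A, B)` of the rows, Alice's maps `τ : A → [m]` and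
Bob's maps `θ : B → [m]` give monomials `κ_τ`, `κ_θ` with `κ_τ · κ_θ = κ_{τ ∪ θ}`.

* `monoOf A τ` (the monomial `Π_{i ∈ A} x_{i,τ i}` of a partial map), `monoMap ν` (total maps),
  their exponents and row degrees (`rowDegrees_monoOf` is the indicator of `A`), injectivity,
  and the converse `exists_eq_monoOf`: a monomial whose row degrees are the indicator of `A`
  IS `κ_τ` for a (unique) `τ` — so the support of an `A`-ordered polynomial
  (`IsOrdered`, `MonotoneStructure.lean`) consists of monomials of maps
  (`IsOrdered.exists_eq_monoOf`).
* `splitEquiv A : (ι → κ) ≃ (A → κ) × (Aᶜ → κ)` (restriction; its inverse is the gluing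
  `τ ∪ θ`) and `monoOf_add_monoOf : κ_τ + κ_θ = κ_{τ ∪ θ}` (exponents add).
* `coeff_monoMap_mul`: for `a` ordered with row set `A` and `b` ordered with row set `Aᶜ`
  (over `ℝ≥0`), the coefficient of `κ_ν` in `a · b` is `a(κ_{ν|A}) · b(κ_{ν|Aᶜ})` — the
  "rectangular" structure of ordered products used in CDGM Lemma 4.1.

Rows `ι` and columns `κ` are finite types with decidable equality; `rowDegrees_eq_sum`
rewrites the row degree of `MonotoneStructure.lean` as a plain sum over the row.

## References

* [ChattopadhyayDattaGhosalMukhopadhyay2022] §4 (monomials as maps, `𝒜_P`, `ℬ_P`,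
  rectangular product polynomials).
-/

noncomputable section

namespace Literature.Computability.AlgebraicComplexity

open MvPolynomial Finset
open scoped NNReal

universe u v

variable {ι : Type u} {κ : Type v} [Fintype ι] [DecidableEq ι] [Fintype κ] [DecidableEq κ]

/-! ### Rows of a monomial -/

omit [Fintype ι] in
/-- With finitely many columns, the row degree is the plain sum over the row. [folklore] -/
theorem rowDegrees_eq_sum (m : ι × κ →₀ ℕ) (i : ι) : rowDegrees m i = ∑ j, m (i, j) := by
  induction m using Finsupp.induction with
  | zero => simp
  | single_add p n f _ _ ih =>
    rw [rowDegrees_add, Finsupp.add_apply, ih, rowDegrees_single, Finsupp.single_apply]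
    simp only [Finsupp.add_apply, sum_add_distrib]
    congr 1
    obtain ⟨a, b⟩ := p
    by_cases hai : a = i
    · subst hai
      rw [if_pos rfl, Finset.sum_eq_single b]
      · simp
      · intro j _ hj; rw [Finsupp.single_apply, if_neg]; simp [Ne.symm hj]
      · simp
    · rw [if_neg hai]
      symm
      apply Finset.sum_eq_zero
      intro j _
      rw [Finsupp.single_apply, if_neg]
      simp [hai]

omit [Fintype ι] [DecidableEq ι] [DecidableEq κ] in
/-- A sum of naturals is `1` iff exactly one term is `1` and the others vanish. [folklore] -/
theorem exists_of_sum_eq_one {g : κ → ℕ} (h : ∑ j, g j = 1) :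
    ∃ j, g j = 1 ∧ ∀ j', j' ≠ j → g j' = 0 := by
  classical
  obtain ⟨j, -, hj⟩ : ∃ j ∈ (univ : Finset κ), g j ≠ 0 := by
    by_contra hne
    push Not at hne
    rw [Finset.sum_eq_zero hne] at h
    exact zero_ne_one h
  have hle : ∀ j' ≠ j, g j + g j' ≤ 1 := by
    intro j' hj'
    rw [← h, ← Finset.sum_pair (Ne.symm hj')]
    exact Finset.sum_le_sum_of_subset (by simp)
  have hj1 : g j ≤ 1 := h ▸ Finset.single_le_sum (fun _ _ => Nat.zero_le _) (mem_univ j)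
  refine ⟨j, by omega, fun j' hj' => ?_⟩
  have := hle j' hj'
  omega

/-! ### Monomials of (partial) maps -/

/-- The monomial `Π_{i ∈ A} x_{i, τ(i)}` of a map `τ : A → κ` on a set of rows `A` (CDGM §4:
"any map `τ ∈ 𝒜_P` gives a set-multilinear monomial `κ_τ` of degree `|A|`").
[cite: ChattopadhyayDattaGhosalMukhopadhyay2022, §4] -/
def monoOf (A : Finset ι) (τ : {i // i ∈ A} → κ) : ι × κ →₀ ℕ :=
  ∑ i : {i // i ∈ A}, Finsupp.single (i.1, τ i) 1

/-- The monomial `Π_i x_{i, ν(i)}` of a total map `ν : ι → κ` ("we identify a monomial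
`κ_ν ∈ 𝕄[X]` with a map `ν : [n] → [m]`"). [cite: ChattopadhyayDattaGhosalMukhopadhyay2022, §4] -/
def monoMap (ν : ι → κ) : ι × κ →₀ ℕ :=
  ∑ i, Finsupp.single (i, ν i) 1

omit [Fintype ι] [Fintype κ] in
/-- Exponents of the monomial of a partial map. [folklore] -/
theorem monoOf_apply (A : Finset ι) (τ : {i // i ∈ A} → κ) (i : ι) (j : κ) :
    monoOf A τ (i, j) = if h : i ∈ A then (if τ ⟨i, h⟩ = j then 1 else 0) else 0 := by
  unfold monoOf
  rw [Finsupp.finsetSum_apply]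
  by_cases hi : i ∈ A
  · rw [dif_pos hi, Finset.sum_eq_single ⟨i, hi⟩]
    · simp [Finsupp.single_apply]
    · rintro ⟨i', hi'⟩ _ hne
      rw [Finsupp.single_apply, if_neg]
      intro h
      apply hne
      exact Subtype.ext (Prod.mk.inj h).1
    · simp
  · rw [dif_neg hi]
    apply Finset.sum_eq_zero
    rintro ⟨i', hi'⟩ _
    rw [Finsupp.single_apply, if_neg]
    rintro ⟨rfl, -⟩
    exact hi hi'

omit [Fintype κ] in
/-- Exponents of the monomial of a total map. [folklore] -/
theorem monoMap_apply (ν : ι → κ) (i : ι) (j : κ) :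
    monoMap ν (i, j) = if ν i = j then 1 else 0 := by
  unfold monoMap
  rw [Finsupp.finsetSum_apply, Finset.sum_eq_single i]
  · simp [Finsupp.single_apply]
  · intro i' _ hne
    rw [Finsupp.single_apply, if_neg]
    rintro ⟨rfl, -⟩
    exact hne rfl
  · simp

omit [Fintype ι] in
/-- Row degrees of the monomial of a partial map: the indicator of its row set. [folklore] -/
theorem rowDegrees_monoOf (A : Finset ι) (τ : {i // i ∈ A} → κ) (i : ι) :
    rowDegrees (monoOf A τ) i = if i ∈ A then 1 else 0 := by
  rw [rowDegrees_eq_sum]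
  simp_rw [monoOf_apply]
  by_cases hi : i ∈ A
  · simp [hi]
  · simp [hi]

/-- Row degrees of the monomial of a total map are all `1`. [folklore] -/
theorem rowDegrees_monoMap (ν : ι → κ) (i : ι) : rowDegrees (monoMap ν) i = 1 := by
  rw [rowDegrees_eq_sum]
  simp_rw [monoMap_apply]
  simp

omit [Fintype ι] [Fintype κ] in
/-- The monomial determines the map. [folklore] -/
theorem monoOf_injective (A : Finset ι) : Function.Injective (monoOf (κ := κ) A) := by
  intro τ τ' h
  funext ⟨i, hi⟩
  have := congrArg (fun m => m (i, τ ⟨i, hi⟩)) h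
  simp only [monoOf_apply, dif_pos hi, if_true] at this
  by_contra hne
  rw [if_neg (Ne.symm hne)] at this
  exact one_ne_zero this

omit [Fintype κ] in
/-- The monomial determines the total map. [folklore] -/
theorem monoMap_injective : Function.Injective (monoMap (ι := ι) (κ := κ)) := by
  intro ν ν' h
  funext i
  have := congrArg (fun m => m (i, ν i)) h
  simp only [monoMap_apply, if_true] at this
  by_contra hne
  rw [if_neg (Ne.symm hne)] at this
  exact one_ne_zero this

omit [Fintype ι] in
/-- A monomial whose row degrees are the indicator of `A` is the monomial of a map on `A`.
[cite: ChattopadhyayDattaGhosalMukhopadhyay2022, §4 ("This forms a bijection")] -/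
theorem exists_eq_monoOf {A : Finset ι} {m : ι × κ →₀ ℕ}
    (h : ∀ i, rowDegrees m i = if i ∈ A then 1 else 0) : ∃ τ, m = monoOf A τ := by
  have h1 : ∀ i ∈ A, ∃ j, m (i, j) = 1 ∧ ∀ j', j' ≠ j → m (i, j') = 0 := by
    intro i hi
    have := h i
    rw [if_pos hi, rowDegrees_eq_sum] at this
    exact exists_of_sum_eq_one this
  have h0 : ∀ i, i ∉ A → ∀ j, m (i, j) = 0 := by
    intro i hi j
    have := h i
    rw [if_neg hi, rowDegrees_eq_sum, Finset.sum_eq_zero_iff] at this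
    exact this j (mem_univ j)
  choose τ hτ using h1
  refine ⟨fun i => τ i.1 i.2, Finsupp.ext fun ⟨i, j⟩ => ?_⟩
  rw [monoOf_apply]
  by_cases hi : i ∈ A
  · rw [dif_pos hi]
    by_cases hj : τ i hi = j
    · rw [if_pos hj, ← hj]; exact (hτ i hi).1
    · rw [if_neg hj]; exact (hτ i hi).2 j (Ne.symm hj)
  · rw [dif_neg hi]; exact h0 i hi j

/-- Splitting a total map into Alice's part on `A` and Bob's part on `Aᶜ` (the gluing
`(τ, θ) ↦ τ ∪ θ` is its inverse): the bijection behind "the monomial `κ_τ · κ_θ`".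
[cite: ChattopadhyayDattaGhosalMukhopadhyay2022, §4] -/
def splitEquiv (A : Finset ι) : (ι → κ) ≃ ({i // i ∈ A} → κ) × ({i // i ∈ Aᶜ} → κ) where
  toFun ν := (fun i => ν i.1, fun i => ν i.1)
  invFun p i := if h : i ∈ A then p.1 ⟨i, h⟩ else p.2 ⟨i, Finset.mem_compl.2 h⟩
  left_inv ν := by
    funext i
    simp only
    split_ifs <;> rfl
  right_inv p := by
    obtain ⟨τ, θ⟩ := p
    simp only [Prod.mk.injEq]
    refine ⟨funext fun i => by rw [dif_pos i.2], funext fun i => ?_⟩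
    rw [dif_neg (Finset.mem_compl.1 i.2)]

omit [Fintype κ] [DecidableEq κ] in
/-- Alice's part of a glued map. [folklore] -/
@[simp] theorem splitEquiv_symm_apply_mem (A : Finset ι) (τ : {i // i ∈ A} → κ)
    (θ : {i // i ∈ Aᶜ} → κ) (i : {i // i ∈ A}) : (splitEquiv A).symm (τ, θ) i.1 = τ i := by
  change (if h : i.1 ∈ A then τ ⟨i.1, h⟩ else θ ⟨i.1, _⟩) = τ i
  rw [dif_pos i.2]

omit [Fintype κ] [DecidableEq κ] in
/-- Bob's part of a glued map. [folklore] -/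
@[simp] theorem splitEquiv_symm_apply_compl (A : Finset ι) (τ : {i // i ∈ A} → κ)
    (θ : {i // i ∈ Aᶜ} → κ) (i : {i // i ∈ Aᶜ}) : (splitEquiv A).symm (τ, θ) i.1 = θ i := by
  change (if h : i.1 ∈ A then τ ⟨i.1, h⟩ else θ ⟨i.1, _⟩) = θ i
  rw [dif_neg (Finset.mem_compl.1 i.2)]

omit [Fintype κ] in
/-- The monomial of a glued map is the product of the two monomials:
`κ_τ · κ_θ = κ_{τ ∪ θ}`. [cite: ChattopadhyayDattaGhosalMukhopadhyay2022, §4] -/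
theorem monoOf_add_monoOf (A : Finset ι) (τ : {i // i ∈ A} → κ) (θ : {i // i ∈ Aᶜ} → κ) :
    monoOf A τ + monoOf Aᶜ θ = monoMap ((splitEquiv A).symm (τ, θ)) := by
  ext ⟨i, j⟩
  rw [Finsupp.add_apply, monoOf_apply, monoOf_apply, monoMap_apply]
  by_cases hi : i ∈ A
  · rw [dif_pos hi, dif_neg (by simpa using hi), add_zero,
      show (splitEquiv A).symm (τ, θ) i = τ ⟨i, hi⟩ from splitEquiv_symm_apply_mem A τ θ ⟨i, hi⟩]
  · have hi' : i ∈ Aᶜ := by simpa using hi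
    rw [dif_neg hi, dif_pos hi', zero_add,
      show (splitEquiv A).symm (τ, θ) i = θ ⟨i, hi'⟩ from splitEquiv_symm_apply_compl A τ θ ⟨i, hi'⟩]

omit [Fintype κ] in
/-- The monomial of a total map splits along every row set. [folklore] -/
theorem monoOf_add_monoOf_restrict (A : Finset ι) (ν : ι → κ) :
    monoOf A (fun i => ν i.1) + monoOf Aᶜ (fun i => ν i.1) = monoMap ν := by
  have h := monoOf_add_monoOf A (fun i => ν i.1) (fun i => ν i.1)
  rwa [show ((fun i : {i // i ∈ A} => ν i.1), (fun i : {i // i ∈ Aᶜ} => ν i.1)) =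
    splitEquiv A ν from rfl, Equiv.symm_apply_apply] at h

/-! ### Coefficients of ordered products -/

omit [Fintype ι] in
/-- The support of an ordered polynomial consists of monomials of maps on its row set.
[cite: ChattopadhyayDattaGhosalMukhopadhyay2022, §4] -/
theorem IsOrdered.exists_eq_monoOf {A : Finset ι} {f : MvPolynomial (ι × κ) ℝ≥0}
    (hf : IsOrdered A f) {m : ι × κ →₀ ℕ} (hm : m ∈ f.support) : ∃ τ, m = monoOf A τ :=
  Literature.Computability.AlgebraicComplexity.exists_eq_monoOf (hf m hm)

/-- **Coefficients of an ordered product**: if `a` is ordered with row set `A` and `b` with the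
complementary row set, the coefficient of `κ_ν` in `a · b` is `a(κ_{ν|A}) · b(κ_{ν|Aᶜ})`.
[cite: ChattopadhyayDattaGhosalMukhopadhyay2022, §4 (rectangular product polynomials)] -/
theorem coeff_monoMap_mul {A : Finset ι} {a b : MvPolynomial (ι × κ) ℝ≥0}
    (ha : IsOrdered A a) (hb : IsOrdered Aᶜ b) (ν : ι → κ) :
    coeff (monoMap ν) (a * b) =
      coeff (monoOf A fun i => ν i.1) a * coeff (monoOf Aᶜ fun i => ν i.1) b := by
  classical
  rw [coeff_mul]
  have hν := monoOf_add_monoOf_restrict A ν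
  rw [Finset.sum_eq_single (monoOf A fun i => ν i.1, monoOf Aᶜ fun i => ν i.1)]
  · rintro ⟨u, v⟩ huv hne
    rw [Finset.mem_antidiagonal] at huv
    by_contra h0
    rcases ne_or_eq (coeff u a) 0 with hu | hu
    · rcases ne_or_eq (coeff v b) 0 with hv | hv
      · obtain ⟨τ, rfl⟩ := ha.exists_eq_monoOf (mem_support_iff.2 hu)
        obtain ⟨θ, rfl⟩ := hb.exists_eq_monoOf (mem_support_iff.2 hv)
        apply hne
        have hτ : τ = fun i => ν i.1 := by
          funext ⟨i, hi⟩
          have := congrArg (fun m => m (i, τ ⟨i, hi⟩)) huv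
          simp only [Finsupp.add_apply, monoOf_apply, dif_pos hi, if_true, monoMap_apply] at this
          by_contra hc
          rw [if_neg (fun h => hc h.symm)] at this
          omega
        have hθ : θ = fun i => ν i.1 := by
          funext ⟨i, hi⟩
          have := congrArg (fun m => m (i, θ ⟨i, hi⟩)) huv
          have hi' : i ∉ A := by simpa using hi
          simp only [Finsupp.add_apply, monoOf_apply, dif_neg hi', dif_pos hi, if_true,
            monoMap_apply] at this
          by_contra hc
          rw [if_neg (fun h => hc h.symm)] at this
          omega
        rw [hτ, hθ]
      · exact h0 (by rw [hv, mul_zero])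
    · exact h0 (by rw [hu, zero_mul])
  · intro h
    exact absurd (Finset.mem_antidiagonal.2 hν) h

end Literature.Computability.AlgebraicComplexity
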